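import Summits.AtomisticToContinuum.HydrodynamicLimit.Theorems.RelayRaceLocalityConeLocalisationStubLogSlopeA
import Literature.MathematicalPhysics.KineticTheory.HardSphereEulerPrimitiveForm
import HarnessLib

/-!
# RelayRaceLocality · ConeLocalisation — line `einstein-elevator`, stub `stub_logSlope` (part B)

Support file for the crux item `stmt-AtomisticToContinuum-12504` (`ConeLocalisation`, route RelayRaceLocality of
`AtomisticToContinuum/HydrodynamicLimit`), second of three files proving the registered stub
`stub_logSlope : DynamicLogSlopeBound` of the line `einstein-elevator`.

This part (namespace `…Elevator.LogSlope`): the primitive hard-sphere Euler equations in MATERIAL form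
`D_t = ∂ₜ + Σᵢ uᵢ ∂ᵢ` along one classical solution whose packing stays in the smooth EOS band
(`Dt_velocity`: `D_t uⱼ = -(θ κ(ρσ³) ∂ⱼρ/ρ + Zf(ρσ³) ∂ⱼθ)`; `Dt_density`; `Dt_temperature`;
`timeDeriv_dTemperature`; and the floor-free identity `Dt_logSlope`:
`D_t ∂ⱼ log ρ = -∂ⱼ div u - Σᵢ ∂ⱼuᵢ ∂ᵢ log ρ` — the `1/ρ`'s cancel), and the resulting
material-derivative BOUNDS at a point where the level-`M` guards hold (`pointwise_bounds`).
-/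

noncomputable section

namespace Summit.AtomisticToContinuum.HydrodynamicLimit.Theorems.ConeLocalisation.Elevator.LogSlope

open scoped Topology ContDiff NNReal
open Filter Set MeasureTheory
open Literature.MathematicalPhysics.KineticTheory Literature.Analysis.FluidPDE
  Literature.Analysis.FunctionSpaces
open Literature.Analysis.FluidPDE.CompressibleEuler (abs_mul_le_of_le)
open Literature.MathematicalPhysics.KineticTheory.HsEulerCalc

/-! ### Step 5: the primitive equations in material form (Eulerian, pointwise) -/

section Eulerian

variable {σ T η₀ : ℝ} {ρ θ : ℝ → T3 → ℝ} {u : ℝ → T3 → V3} {Zf : ℝ → ℝ}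

/-- The rescaled compressibility `ζ r = Zf (r σ³)` is smooth on the open set `{r | r σ³ ∈ (-η₀, η₀)}`,
with `ζ' r = Zf'(r σ³) σ³` there. [folklore] -/
theorem zeta_smooth (hZ : ContDiffOn ℝ ∞ Zf (Ioo (-η₀) η₀)) (σ : ℝ) :
    IsOpen {r : ℝ | r * σ ^ 3 ∈ Ioo (-η₀) η₀} ∧
    ContDiffOn ℝ ∞ (fun r => Zf (r * σ ^ 3)) {r : ℝ | r * σ ^ 3 ∈ Ioo (-η₀) η₀} ∧
    ∀ r ∈ {r : ℝ | r * σ ^ 3 ∈ Ioo (-η₀) η₀},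
      deriv (fun r => Zf (r * σ ^ 3)) r = deriv Zf (r * σ ^ 3) * σ ^ 3 := by
  have hc : Continuous fun r : ℝ => r * σ ^ 3 := continuous_id.mul continuous_const
  have hO : IsOpen {r : ℝ | r * σ ^ 3 ∈ Ioo (-η₀) η₀} := isOpen_Ioo.preimage hc
  refine ⟨hO, hZ.comp (contDiff_id.mul contDiff_const).contDiffOn (fun r hr => hr), fun r hr => ?_⟩
  have hd : HasDerivAt Zf (deriv Zf (r * σ ^ 3)) (r * σ ^ 3) :=
    ((hZ.differentiableOn (by simp)).differentiableAt (isOpen_Ioo.mem_nhds hr)).hasDerivAt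
  have h2 : HasDerivAt (fun r : ℝ => r * σ ^ 3) (σ ^ 3) r := by
    simpa using (hasDerivAt_id r).mul_const (σ ^ 3)
  exact (hd.comp r h2).deriv

/-- Along a classical solution with packing `< η₀` on `[0, T) × 𝕋³`, the density takes values in the
smoothness set of `ζ`, and the pressure is `ρ θ Zf(ρσ³)`. [folklore] -/
theorem density_mem_and_pressure (hE : IsHardSphereEulerSolution σ T ρ u θ)
    (hEq : EqOn hsCompressibility Zf (Ioo 0 η₀)) (hσ : 0 < σ)
    (hpack : ∀ s ∈ Ico 0 T, ∀ x, ρ s x * σ ^ 3 < η₀) :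
    (∀ s ∈ Ico 0 T, ∀ x, ρ s x ∈ {r : ℝ | r * σ ^ 3 ∈ Ioo (-η₀) η₀}) ∧
    ∀ s ∈ Ico 0 T, ∀ x, hsPressure σ (ρ s x) (θ s x) = ρ s x * θ s x * Zf (ρ s x * σ ^ 3) := by
  have hpos : ∀ s ∈ Ico 0 T, ∀ x, 0 < ρ s x * σ ^ 3 := fun s hs x =>
    mul_pos (hE.density_pos s hs x) (pow_pos hσ 3)
  refine ⟨fun s hs x => ⟨?_, hpack s hs x⟩, fun s hs x => ?_⟩
  · have h0 : 0 < η₀ := (hpos s hs x).trans (hpack s hs x)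
    linarith [hpos s hs x]
  · unfold hsPressure
    rw [hEq ⟨hpos s hs x, hpack s hs x⟩]

/-- **Velocity in material form**: `∂ₜuⱼ + Σᵢ uᵢ ∂ᵢuⱼ = -(θ κ(ρσ³) ∂ⱼρ/ρ + Zf(ρσ³) ∂ⱼθ)` with
`κ(η) = Zf η + η Zf' η`. [folklore] -/
theorem Dt_velocity (hE : IsHardSphereEulerSolution σ T ρ u θ)
    (hZ : ContDiffOn ℝ ∞ Zf (Ioo (-η₀) η₀)) (hEq : EqOn hsCompressibility Zf (Ioo 0 η₀))
    (hσ : 0 < σ) (hpack : ∀ s ∈ Ico 0 T, ∀ x, ρ s x * σ ^ 3 < η₀)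
    {s : ℝ} (hs : s ∈ Ico 0 T) (x : T3) (j : Fin 3) :
    Torus.timeDerivWithin (Ico 0 T) (fun s y => u s y j) s x +
        ∑ i, u s x i * Torus.partialDeriv i (fun y => u s y j) x =
      -(θ s x * (Zf (ρ s x * σ ^ 3) + ρ s x * σ ^ 3 * deriv Zf (ρ s x * σ ^ 3)) *
          (Torus.partialDeriv j (ρ s) x / ρ s x) +
        Zf (ρ s x * σ ^ 3) * Torus.partialDeriv j (θ s) x) := by
  obtain ⟨hJ, hζ, hdζ⟩ := zeta_smooth hZ σ
  obtain ⟨hρJ, hp⟩ := density_mem_and_pressure hE hEq hσ hpack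
  have h := hE.density_mul_timeDeriv_velocity_eq hJ hζ hρJ hp hs x j
  rw [hdζ _ (hρJ s hs x)] at h
  have hρ0 : ρ s x ≠ 0 := (hE.density_pos s hs x).ne'
  have e : θ s x * (Zf (ρ s x * σ ^ 3) + ρ s x * σ ^ 3 * deriv Zf (ρ s x * σ ^ 3)) *
        (Torus.partialDeriv j (ρ s) x / ρ s x) =
      (θ s x * (Zf (ρ s x * σ ^ 3) + ρ s x * (deriv Zf (ρ s x * σ ^ 3) * σ ^ 3)) *
          Torus.partialDeriv j (ρ s) x) / ρ s x := by
    rw [mul_div_assoc]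
    ring
  rw [e]
  field_simp
  simp only [Fin.sum_univ_three] at h ⊢
  linear_combination h

/-- **Mass in material form**: `∂ₜρ + Σᵢ uᵢ ∂ᵢρ = -ρ div u`. [folklore] -/
theorem Dt_density (hE : IsHardSphereEulerSolution σ T ρ u θ) {s : ℝ} (hs : s ∈ Ico 0 T)
    (x : T3) :
    Torus.timeDerivWithin (Ico 0 T) ρ s x + ∑ i, u s x i * Torus.partialDeriv i (ρ s) x =
      -(ρ s x * ∑ i, Torus.partialDeriv i (fun y => u s y i) x) := by
  rw [hE.timeDeriv_density_eq hs x]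
  simp only [Fin.sum_univ_three]
  ring

/-- **Temperature in material form**: `∂ₜθ + Σᵢ uᵢ ∂ᵢθ = -(2/3) θ Zf(ρσ³) div u`. [folklore] -/
theorem Dt_temperature (hE : IsHardSphereEulerSolution σ T ρ u θ)
    (hZ : ContDiffOn ℝ ∞ Zf (Ioo (-η₀) η₀)) (hEq : EqOn hsCompressibility Zf (Ioo 0 η₀))
    (hσ : 0 < σ) (hpack : ∀ s ∈ Ico 0 T, ∀ x, ρ s x * σ ^ 3 < η₀)
    {s : ℝ} (hs : s ∈ Ico 0 T) (x : T3) :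
    Torus.timeDerivWithin (Ico 0 T) θ s x + ∑ i, u s x i * Torus.partialDeriv i (θ s) x =
      -(2 / 3 * (θ s x * Zf (ρ s x * σ ^ 3)) * ∑ i, Torus.partialDeriv i (fun y => u s y i) x) := by
  obtain ⟨hJ, hζ, -⟩ := zeta_smooth hZ σ
  obtain ⟨hρJ, hp⟩ := density_mem_and_pressure hE hEq hσ hpack
  rw [hE.timeDeriv_temperature_eq hJ hζ hρJ hp hs x]
  ring

/-- **Time derivative of the temperature gradient**: `∂ₜ∂ⱼθ = ∂ⱼ(∂ₜθ)`, computed from the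
temperature equation by the Leibniz rule along the `j`-th coordinate line. [folklore] -/
theorem timeDeriv_dTemperature (hE : IsHardSphereEulerSolution σ T ρ u θ)
    (hZ : ContDiffOn ℝ ∞ Zf (Ioo (-η₀) η₀)) (hEq : EqOn hsCompressibility Zf (Ioo 0 η₀))
    (hσ : 0 < σ) (hpack : ∀ s ∈ Ico 0 T, ∀ x, ρ s x * σ ^ 3 < η₀)
    {s : ℝ} (hs : s ∈ Ico 0 T) (x : T3) (j : Fin 3) :
    Torus.timeDerivWithin (Ico 0 T) (fun s => Torus.partialDeriv j (θ s)) s x =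
      -(∑ i, (Torus.partialDeriv j (fun y => u s y i) x * Torus.partialDeriv i (θ s) x +
          u s x i * Torus.partialDeriv j (Torus.partialDeriv i (θ s)) x)) -
        2 / 3 * ((Torus.partialDeriv j (θ s) x * Zf (ρ s x * σ ^ 3) +
            θ s x * (deriv Zf (ρ s x * σ ^ 3) * σ ^ 3 * Torus.partialDeriv j (ρ s) x)) *
            ∑ i, Torus.partialDeriv i (fun y => u s y i) x +
          θ s x * Zf (ρ s x * σ ^ 3) *
            ∑ i, Torus.partialDeriv j (Torus.partialDeriv i (fun y => u s y i)) x) := by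
  obtain ⟨hJ, hζ, hdζ⟩ := zeta_smooth hZ σ
  obtain ⟨hρJ, hp⟩ := density_mem_and_pressure hE hEq hσ hpack
  rw [torus_timeDerivWithin_Ico_partialDeriv_comm hE.smooth_temperature hs j x]
  have hfun : Torus.timeDerivWithin (Ico 0 T) θ s = fun y =>
      -(u s y 0 * Torus.partialDeriv 0 (θ s) y + u s y 1 * Torus.partialDeriv 1 (θ s) y +
          u s y 2 * Torus.partialDeriv 2 (θ s) y) -
        2 / 3 * (θ s y * Zf (ρ s y * σ ^ 3)) *
          (Torus.partialDeriv 0 (fun z => u s z 0) y + Torus.partialDeriv 1 (fun z => u s z 1) y +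
            Torus.partialDeriv 2 (fun z => u s z 2) y) := by
    funext y
    rw [hE.timeDeriv_temperature_eq hJ hζ hρJ hp hs y]
    simp only [Fin.sum_univ_three]
  rw [hfun]
  have hθs : Torus.IsSmooth (θ s) := hE.smooth_temperature.isSmooth_slice hs
  have hus : Torus.IsSmooth (u s) := hE.smooth_velocity.isSmooth_slice hs
  have hρ1 : Torus.IsContDiff 1 (ρ s) := (hE.smooth_density.isSmooth_slice hs).isContDiff (by simp)
  have hθ1 : Torus.IsContDiff 1 (θ s) := hθs.isContDiff (by simp)
  have huj1 : ∀ i, Torus.IsContDiff 1 (fun y => u s y i) := fun i =>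
    isContDiff_apply_coord (hus.isContDiff (by simp)) i
  have hDθ1 : ∀ i, Torus.IsContDiff 1 (Torus.partialDeriv i (θ s)) := fun i =>
    (hθs.partialDeriv i).isContDiff (by simp)
  have hDu1 : ∀ i, Torus.IsContDiff 1 (Torus.partialDeriv i (fun y => u s y i)) := fun i =>
    ((hus.apply i).partialDeriv i).isContDiff (by simp)
  have cu := fun k => hasDerivAt_coordLine (huj1 k) x j
  have cθ := hasDerivAt_coordLine hθ1 x j
  have cDθ := fun i => hasDerivAt_coordLine (hDθ1 i) x j
  have cDu := fun i => hasDerivAt_coordLine (hDu1 i) x j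
  have cζ := hasDerivAt_coordLine_comp hρ1 hJ hζ x (hρJ s hs x) j
  rw [hdζ _ (hρJ s hs x)] at cζ
  simp only [Fin.sum_univ_three]
  refine (partialDeriv_eq_of_hasDerivAt (((((cu 0).fun_mul (cDθ 0)).fun_add
    ((cu 1).fun_mul (cDθ 1))).fun_add ((cu 2).fun_mul (cDθ 2))).fun_neg.fun_sub
    (((cθ.fun_mul cζ).const_mul (2 / 3)).fun_mul
      (((cDu 0).fun_add (cDu 1)).fun_add (cDu 2))))).trans ?_
  simp only [zero_smul, Torus.proj_zero, add_zero]
  ring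

/-- The log-density `log ρ` of a classical solution is jointly smooth on `[0, T) × 𝕋³`. [folklore] -/
theorem isSmoothSpaceTimeOn_log (hE : IsHardSphereEulerSolution σ T ρ u θ) :
    Torus.IsSmoothSpaceTimeOn (Ico 0 T) (fun s y => Real.log (ρ s y)) :=
  isSmoothSpaceTimeOn_comp_density hE.smooth_density Real.contDiffOn_log
    fun s hs x => (hE.density_pos s hs x).ne'

/-- `∂ⱼ log ρ = ∂ⱼρ / ρ`. [folklore] -/
theorem partialDeriv_log (hE : IsHardSphereEulerSolution σ T ρ u θ) {s : ℝ} (hs : s ∈ Ico 0 T)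
    (x : T3) (j : Fin 3) :
    Torus.partialDeriv j (fun y => Real.log (ρ s y)) x = Torus.partialDeriv j (ρ s) x / ρ s x := by
  have hρ1 : Torus.IsContDiff 1 (ρ s) := (hE.smooth_density.isSmooth_slice hs).isContDiff (by simp)
  have h := hasDerivAt_coordLine_comp hρ1 isOpen_compl_singleton Real.contDiffOn_log x
    (hE.density_pos s hs x).ne' j
  rw [Real.deriv_log] at h
  rw [partialDeriv_eq_of_hasDerivAt h, div_eq_inv_mul]

/-- `∂ₜ log ρ = -div u - Σᵢ uᵢ ∂ᵢ log ρ`. [folklore] -/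
theorem timeDeriv_log (hE : IsHardSphereEulerSolution σ T ρ u θ) {s : ℝ} (hs : s ∈ Ico 0 T)
    (x : T3) :
    Torus.timeDerivWithin (Ico 0 T) (fun s y => Real.log (ρ s y)) s x =
      -(∑ i, Torus.partialDeriv i (fun y => u s y i) x) -
        ∑ i, u s x i * Torus.partialDeriv i (fun y => Real.log (ρ s y)) x := by
  have hρ0 : ρ s x ≠ 0 := (hE.density_pos s hs x).ne'
  have h : HasDerivWithinAt (fun τ => Real.log (ρ τ x))
      ((ρ s x)⁻¹ * Torus.timeDerivWithin (Ico 0 T) ρ s x) (Ico 0 T) s :=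
    ((Real.hasDerivAt_log hρ0).comp_hasDerivWithinAt s
      (hE.smooth_density.hasDerivWithinAt_slice hs x) :)
  rw [timeDerivWithin_eq_of_hasDerivWithinAt (F := fun s y => Real.log (ρ s y)) h
    (uniqueDiffOn_Ico 0 T s hs), hE.timeDeriv_density_eq hs x]
  simp only [partialDeriv_log hE hs, Fin.sum_univ_three]
  field_simp
  ring

/-- **Log-density gradient in material form** (the `1/ρ`'s cancel):
`∂ₜ∂ⱼ log ρ + Σᵢ uᵢ ∂ᵢ∂ⱼ log ρ = -Σᵢ ∂ⱼ∂ᵢuᵢ - Σᵢ ∂ⱼuᵢ ∂ᵢ log ρ`. [folklore] -/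
theorem Dt_logSlope (hE : IsHardSphereEulerSolution σ T ρ u θ) {s : ℝ} (hs : s ∈ Ico 0 T)
    (x : T3) (j : Fin 3) :
    Torus.timeDerivWithin (Ico 0 T) (fun s => Torus.partialDeriv j (fun y => Real.log (ρ s y))) s x +
        ∑ i, u s x i *
          Torus.partialDeriv i (Torus.partialDeriv j (fun y => Real.log (ρ s y))) x =
      -(∑ i, Torus.partialDeriv j (Torus.partialDeriv i (fun y => u s y i)) x) -
        ∑ i, Torus.partialDeriv j (fun y => u s y i) x *
          Torus.partialDeriv i (fun y => Real.log (ρ s y)) x := by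
  have hL := isSmoothSpaceTimeOn_log hE
  rw [torus_timeDerivWithin_Ico_partialDeriv_comm hL hs j x]
  have hfun : Torus.timeDerivWithin (Ico 0 T) (fun s y => Real.log (ρ s y)) s = fun y =>
      -(Torus.partialDeriv 0 (fun z => u s z 0) y + Torus.partialDeriv 1 (fun z => u s z 1) y +
          Torus.partialDeriv 2 (fun z => u s z 2) y) -
        (u s y 0 * Torus.partialDeriv 0 (fun z => Real.log (ρ s z)) y +
          u s y 1 * Torus.partialDeriv 1 (fun z => Real.log (ρ s z)) y +
          u s y 2 * Torus.partialDeriv 2 (fun z => Real.log (ρ s z)) y) := by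
    funext y
    rw [timeDeriv_log hE hs y]
    simp only [Fin.sum_univ_three]
  rw [hfun]
  have hLs : Torus.IsSmooth (fun y => Real.log (ρ s y)) := hL.isSmooth_slice hs
  have hus : Torus.IsSmooth (u s) := hE.smooth_velocity.isSmooth_slice hs
  have huj1 : ∀ i, Torus.IsContDiff 1 (fun y => u s y i) := fun i =>
    isContDiff_apply_coord (hus.isContDiff (by simp)) i
  have hDu1 : ∀ i, Torus.IsContDiff 1 (Torus.partialDeriv i (fun y => u s y i)) := fun i =>
    ((hus.apply i).partialDeriv i).isContDiff (by simp)
  have hQ1 : ∀ i, Torus.IsContDiff 1 (Torus.partialDeriv i (fun y => Real.log (ρ s y))) := fun i =>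
    (hLs.partialDeriv i).isContDiff (by simp)
  have cu := fun k => hasDerivAt_coordLine (huj1 k) x j
  have cDu := fun i => hasDerivAt_coordLine (hDu1 i) x j
  have cQ := fun i => hasDerivAt_coordLine (hQ1 i) x j
  rw [partialDeriv_eq_of_hasDerivAt ((((cDu 0).fun_add (cDu 1)).fun_add (cDu 2)).fun_neg.fun_sub
    ((((cu 0).fun_mul (cQ 0)).fun_add ((cu 1).fun_mul (cQ 1))).fun_add ((cu 2).fun_mul (cQ 2))))]
  simp only [zero_smul, Torus.proj_zero, add_zero, Fin.sum_univ_three]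
  rw [Torus.partialDeriv_comm hLs 0 j x, Torus.partialDeriv_comm hLs 1 j x,
    Torus.partialDeriv_comm hLs 2 j x]
  ring

/-! ### Step 6: material-derivative bounds at a guarded point -/

/-- **Material-derivative bounds at a guarded point.** At `(s, x)` where the level-`M` guards hold
(and `N ≥ max M K`, `K` the EOS constant): `|D_t θ| ≤ 2N³`, `σ³ |D_t ρ| ≤ 3N`,
`|D_t ∂ⱼθ| ≤ 15 N⁴` and `|D_t ∂ⱼ log ρ| ≤ 3N + N Σᵢ |∂ᵢ log ρ|` (no density floor). [folklore] -/
theorem pointwise_bounds (hE : IsHardSphereEulerSolution σ T ρ u θ)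
    (hZ : ContDiffOn ℝ ∞ Zf (Ioo (-η₀) η₀)) (hEq : EqOn hsCompressibility Zf (Ioo 0 η₀))
    (hσ : 0 < σ) (hσ1 : σ ≤ 1) {η₁ K M N : ℝ} (hη₁1 : η₁ ≤ 1) (hη₁₀ : 2 * η₁ ≤ η₀)
    (hband : ∀ η ∈ Icc 0 η₁, |Zf η| ≤ K ∧ |deriv Zf η| ≤ K ∧ |deriv (deriv Zf) η| ≤ K ∧
      1 / 2 ≤ Zf η ∧ 1 / 2 ≤ Zf η + η * deriv Zf η)
    (hN : 1 ≤ N) (hMN : M ≤ N) (hKN : K ≤ N)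
    (hpack : ∀ s ∈ Ico 0 T, ∀ x, ρ s x * σ ^ 3 < η₁)
    {s : ℝ} (hs : s ∈ Ico 0 T) {x : T3} (hG : GuardAt η₁ M σ ρ θ u s x) :
    |Torus.timeDerivWithin (Ico 0 T) θ s x + ∑ i, u s x i * Torus.partialDeriv i (θ s) x| ≤
        2 * N ^ 3 ∧
    |(Torus.timeDerivWithin (Ico 0 T) ρ s x + ∑ i, u s x i * Torus.partialDeriv i (ρ s) x) *
        σ ^ 3| ≤ 3 * N ∧
    (∀ j, |Torus.timeDerivWithin (Ico 0 T) (fun s => Torus.partialDeriv j (θ s)) s x +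
        ∑ i, u s x i * Torus.partialDeriv i (Torus.partialDeriv j (θ s)) x| ≤ 15 * N ^ 4) ∧
    (∀ j, |Torus.timeDerivWithin (Ico 0 T)
          (fun s => Torus.partialDeriv j (fun y => Real.log (ρ s y))) s x +
        ∑ i, u s x i *
          Torus.partialDeriv i (Torus.partialDeriv j (fun y => Real.log (ρ s y))) x| ≤
        3 * N + N * ∑ i, |Torus.partialDeriv i (fun y => Real.log (ρ s y)) x|) := by
  have hη₁ : 0 < η₁ :=
    (mul_pos (hE.density_pos s hs x) (pow_pos hσ 3)).trans hG.1
  have hη₀ : ∀ s ∈ Ico 0 T, ∀ x, ρ s x * σ ^ 3 < η₀ := fun s' hs' x' =>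
    (hpack s' hs' x').trans_le (by linarith)
  have hus : Torus.IsSmooth (u s) := hE.smooth_velocity.isSmooth_slice hs
  obtain ⟨hpk, hθN, -, hu, hdρ, hdθ, hddθ, hdu, hddu⟩ := guard_bounds hG hMN hus
  have hρpos := hE.density_pos s hs x
  have hθpos := hE.temperature_pos s hs x
  have hηmem : ρ s x * σ ^ 3 ∈ Icc 0 η₁ := ⟨(mul_pos hρpos (pow_pos hσ 3)).le, hpk.le⟩
  obtain ⟨bZ, bZ', -, -, -⟩ := hband _ hηmem
  have hθa : |θ s x| ≤ N := by rw [abs_of_pos hθpos]; exact hθN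
  have hZa : |Zf (ρ s x * σ ^ 3)| ≤ N := bZ.trans hKN
  have hZ'a : |deriv Zf (ρ s x * σ ^ 3)| ≤ N := bZ'.trans hKN
  have hσ3 : |σ ^ 3| ≤ 1 := by
    rw [abs_of_pos (pow_pos hσ 3)]
    exact pow_le_one₀ hσ.le hσ1
  have hN0 : 0 ≤ N := by linarith
  have p23 : N ^ 2 ≤ N ^ 3 := pow_le_pow_right₀ hN (by norm_num)
  have p24 : N ^ 2 ≤ N ^ 4 := pow_le_pow_right₀ hN (by norm_num)
  have p34 : N ^ 3 ≤ N ^ 4 := pow_le_pow_right₀ hN (by norm_num)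
  have hdiv : |Torus.partialDeriv 0 (fun y => u s y 0) x + Torus.partialDeriv 1 (fun y => u s y 1) x +
      Torus.partialDeriv 2 (fun y => u s y 2) x| ≤ 3 * N := by
    rw [abs_le]
    constructor <;> linarith [(abs_le.1 (hdu 0 0)).1, (abs_le.1 (hdu 0 0)).2,
      (abs_le.1 (hdu 1 1)).1, (abs_le.1 (hdu 1 1)).2, (abs_le.1 (hdu 2 2)).1,
      (abs_le.1 (hdu 2 2)).2]
  refine ⟨?_, ?_, fun j => ?_, fun j => ?_⟩
  · rw [Dt_temperature hE hZ hEq hσ hη₀ hs x, abs_neg]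
    simp only [Fin.sum_univ_three]
    calc _ ≤ 2 / 3 * (N * N) * (3 * N) :=
          abs_mul_le_of_le (abs_mul_le_of_le (le_of_eq (abs_of_pos (by norm_num))) (abs_mul_le_of_le hθa hZa)) hdiv
      _ = 2 * N ^ 3 := by ring
  · rw [Dt_density hE hs x]
    simp only [Fin.sum_univ_three]
    have e : -(ρ s x * (Torus.partialDeriv 0 (fun y => u s y 0) x +
        Torus.partialDeriv 1 (fun y => u s y 1) x + Torus.partialDeriv 2 (fun y => u s y 2) x)) *
        σ ^ 3 = -(ρ s x * σ ^ 3 * (Torus.partialDeriv 0 (fun y => u s y 0) x +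
        Torus.partialDeriv 1 (fun y => u s y 1) x + Torus.partialDeriv 2 (fun y => u s y 2) x)) := by
      ring
    rw [e, abs_neg, abs_mul, abs_of_pos (mul_pos hρpos (pow_pos hσ 3))]
    calc _ ≤ 1 * (3 * N) := mul_le_mul (hpk.le.trans hη₁1) hdiv (abs_nonneg _) zero_le_one
      _ = 3 * N := one_mul _
  · rw [timeDeriv_dTemperature hE hZ hEq hσ hη₀ hs x j]
    simp only [Fin.sum_univ_three]
    have hddiv : |Torus.partialDeriv j (Torus.partialDeriv 0 fun y => u s y 0) x +
        Torus.partialDeriv j (Torus.partialDeriv 1 fun y => u s y 1) x +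
        Torus.partialDeriv j (Torus.partialDeriv 2 fun y => u s y 2) x| ≤ 3 * N := by
      rw [abs_le]
      constructor <;> linarith [(abs_le.1 (hddu j 0 0)).1, (abs_le.1 (hddu j 0 0)).2,
        (abs_le.1 (hddu j 1 1)).1, (abs_le.1 (hddu j 1 1)).2, (abs_le.1 (hddu j 2 2)).1,
        (abs_le.1 (hddu j 2 2)).2]
    have A0 := abs_mul_le_of_le (hdu j 0) (hdθ 0)
    have A1 := abs_mul_le_of_le (hdu j 1) (hdθ 1)
    have A2 := abs_mul_le_of_le (hdu j 2) (hdθ 2)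
    have B0 := abs_mul_le_of_le (hu 0) (hddθ j 0)
    have B1 := abs_mul_le_of_le (hu 1) (hddθ j 1)
    have B2 := abs_mul_le_of_le (hu 2) (hddθ j 2)
    have U0 := abs_mul_le_of_le (hu 0) (hddθ 0 j)
    have U1 := abs_mul_le_of_le (hu 1) (hddθ 1 j)
    have U2 := abs_mul_le_of_le (hu 2) (hddθ 2 j)
    have C1 := abs_mul_le_of_le (hdθ j) hZa
    have C2 := abs_mul_le_of_le hθa (abs_mul_le_of_le (abs_mul_le_of_le hZ'a hσ3) (hdρ j))
    have P1 := abs_mul_le_of_le ((abs_add_le _ _).trans (add_le_add C1 C2)) hdiv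
    have P2 := abs_mul_le_of_le (abs_mul_le_of_le hθa hZa) hddiv
    rw [abs_le]
    constructor <;> linarith [(abs_le.1 A0).1, (abs_le.1 A0).2, (abs_le.1 A1).1, (abs_le.1 A1).2,
      (abs_le.1 A2).1, (abs_le.1 A2).2, (abs_le.1 B0).1, (abs_le.1 B0).2, (abs_le.1 B1).1,
      (abs_le.1 B1).2, (abs_le.1 B2).1, (abs_le.1 B2).2, (abs_le.1 U0).1, (abs_le.1 U0).2,
      (abs_le.1 U1).1, (abs_le.1 U1).2, (abs_le.1 U2).1, (abs_le.1 U2).2,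
      (abs_le.1 P1).1, (abs_le.1 P1).2, (abs_le.1 P2).1, (abs_le.1 P2).2]
  · rw [Dt_logSlope hE hs x j]
    simp only [Fin.sum_univ_three]
    have hddiv : |Torus.partialDeriv j (Torus.partialDeriv 0 fun y => u s y 0) x +
        Torus.partialDeriv j (Torus.partialDeriv 1 fun y => u s y 1) x +
        Torus.partialDeriv j (Torus.partialDeriv 2 fun y => u s y 2) x| ≤ 3 * N := by
      rw [abs_le]
      constructor <;> linarith [(abs_le.1 (hddu j 0 0)).1, (abs_le.1 (hddu j 0 0)).2,
        (abs_le.1 (hddu j 1 1)).1, (abs_le.1 (hddu j 1 1)).2, (abs_le.1 (hddu j 2 2)).1,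
        (abs_le.1 (hddu j 2 2)).2]
    have T0 := abs_mul_le_of_le (hdu j 0) (le_refl |Torus.partialDeriv 0 (fun y => Real.log (ρ s y)) x|)
    have T1 := abs_mul_le_of_le (hdu j 1) (le_refl |Torus.partialDeriv 1 (fun y => Real.log (ρ s y)) x|)
    have T2 := abs_mul_le_of_le (hdu j 2) (le_refl |Torus.partialDeriv 2 (fun y => Real.log (ρ s y)) x|)
    rw [abs_le]
    constructor <;> linarith [(abs_le.1 T0).1, (abs_le.1 T0).2, (abs_le.1 T1).1, (abs_le.1 T1).2,
      (abs_le.1 T2).1, (abs_le.1 T2).2, (abs_le.1 hddiv).1, (abs_le.1 hddiv).2]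

end Eulerian

end Summit.AtomisticToContinuum.HydrodynamicLimit.Theorems.ConeLocalisation.Elevator.LogSlope

namespace Summit.AtomisticToContinuum.HydrodynamicLimit.Theorems.ConeLocalisation.Elevator

open Literature.MathematicalPhysics.KineticTheory Literature.Analysis.FunctionSpaces

/-- **Registered sub-goal `stub_logSlope_partB` of the stub `stub_logSlope`** (part B of its proof, registered on
stmt-AtomisticToContinuum-12504 for the supports lane): the floor-free material form of the log-density
gradient, `D_t ∂ⱼ log ρ = -∂ⱼ div u - Σᵢ ∂ⱼuᵢ ∂ᵢ log ρ`. [folklore] -/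
theorem stub_logSlope_partB : ∀ {σ T : ℝ} {ρ θ : ℝ → T3 → ℝ} {u : ℝ → T3 → V3}, IsHardSphereEulerSolution σ T ρ u θ → ∀ {s : ℝ}, s ∈ Set.Ico 0 T → ∀ (x : T3) (j : Fin 3), Torus.timeDerivWithin (Set.Ico 0 T) (fun s => Torus.partialDeriv j (fun y => Real.log (ρ s y))) s x + ∑ i, u s x i * Torus.partialDeriv i (Torus.partialDeriv j (fun y => Real.log (ρ s y))) x = -(∑ i, Torus.partialDeriv j (Torus.partialDeriv i (fun y => u s y i)) x) - ∑ i, Torus.partialDeriv j (fun y => u s y i) x * Torus.partialDeriv i (fun y => Real.log (ρ s y)) x :=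
  fun hE _ hs x j => LogSlope.Dt_logSlope hE hs x j

end Summit.AtomisticToContinuum.HydrodynamicLimit.Theorems.ConeLocalisation.Elevator

end
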